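import Literature.Probability.RandomPlanarGeometry.SAWExplorationFiltration
import Mathlib.Order.PartialSups
import HarnessLib

/-!
# The exploration filtration of the self-avoiding walk run with a running-maximum clock

Topic `Literature/Probability/RandomPlanarGeometry`; theorems only. A companion of
`SAWExplorationFiltration.lean` (`SAW.exists_explorationFiltration`: the filtration generated by
the pasts `γ[0,n]` of a self-avoiding walk of a discrete domain, the Doob identity, and the first
passage indices `σ ≤ τ` of a prefix-determined real clock above two levels `s ≤ t`). In the
passage of discrete martingale observables to the scaling limit (Duminil-Copin–Smirnov, Clay
Math. Proc. 15 (2012), Lemma 6.6 and proof of Prop. 6.7; Chelkak–Duminil-Copin–Hongler–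
Kemppainen–Smirnov, C. R. Math. 352 (2014), §3: "the first step at which the capacity exceeds
`s`") the natural clock — the half-plane capacity `f γ n` of the past `γ[0,n]` read in `ℍ` — need
not be monotone in `n` for a lattice walk with its stem, while the hypotheses controlling it come
as "no one-step increment `> θ` below the horizon `T`, and the horizon is exceeded". Running the
exploration with the RUNNING MAXIMUM `n ↦ max_{i ≤ n} f γ i` (still prefix-determined) gives first
passages `σ, τ` at which the clock itself sits in `[s, s + θ]`, resp. `[t, t + θ]`
(`exists_explorationFiltration_runningMax`), together with the measurability criterion for the
stopped σ-algebra `𝒢_σ` in the form "determined by a past `γ[0,i]`, `i ≤ σ`, of clock `≥ s`".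

No definitions, no named facts.

## References

* H. Duminil-Copin, S. Smirnov, *Conformal invariance of lattice models*, Clay Math. Proc. 15
  (2012), Lemma 6.6, proof of Prop. 6.7.
* D. Chelkak, H. Duminil-Copin, C. Hongler, A. Kemppainen, S. Smirnov, C. R. Math. 352 (2014), §3.
-/

noncomputable section

open MeasureTheory Filter Set
open scoped ENNReal NNReal Classical
open Literature.Probability.LatticeModels (Site discreteDomainGraph)

namespace Literature.Probability.RandomPlanarGeometry.SAW

variable {Ω : Set ℂ} {δ : ℝ} {a b : Site 2}

/-- **The exploration package with the running-maximum clock.** On the finite space of SAWs of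
`Ω_δ` from `a` to `b`, let `f γ n` be a real clock determined by the past `γ[0,n]`, with
`f γ 0 ≤ θ` (`θ ≥ 0`), and `s ≤ t` two levels. There are a filtration `𝒢` (generated by the
pasts), a bound `M`, and `𝒢`-stopping times `σ ≤ τ ≤ M` (first passages of the running maximum
`max_{i ≤ n} f γ i` above `s`, `t`) such that: (i) past-determined maps are `𝒢 n`-measurable;
(ii) the Doob identity `μ[X ∣ 𝒢 n] = ` cylinder average, a.e., for every finite measure; (iii) a
real map is `𝒢_σ`-measurable as soon as, on `{σ = k}`, it is determined by some past `γ[0,i]`,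
`i ≤ k`, of clock `f γ i ≥ s`; (iv) for a walk whose clock exceeds a horizon `T ≥ s + θ` at some
step and has one-step increments `≤ θ` below `T`, `σ = k` with `s ≤ f γ k ≤ s + θ`; same for
`τ, t`. [cite: DuminilCopinSmirnov2012Clay, Lemma 6.6] -/
theorem exists_explorationFiltration_runningMax [Finite (DomainSAW Ω δ a b)]
    (f : DomainSAW Ω δ a b → ℕ → ℝ)
    (hf : ∀ (γ γ' : DomainSAW Ω δ a b) (n n' : ℕ),
      (γ.walk.takeUntil (γ.walk.getVert n) (γ.walk.getVert_mem_support n)).support =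
        (γ'.walk.takeUntil (γ'.walk.getVert n') (γ'.walk.getVert_mem_support n')).support →
      f γ n = f γ' n')
    {θ : ℝ} (hθ : 0 ≤ θ) (h0 : ∀ γ, f γ 0 ≤ θ) {s t : ℝ} (hs : 0 ≤ s) (hst : s ≤ t) :
    ∃ (𝒢 : Filtration ℕ (inferInstance : MeasurableSpace (DomainSAW Ω δ a b))) (M : ℕ)
      (σ τ : DomainSAW Ω δ a b → WithTop ℕ) (hσ : IsStoppingTime 𝒢 σ),
      IsStoppingTime 𝒢 τ ∧ σ ≤ τ ∧ (∀ γ, τ γ ≤ M) ∧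
      (∀ (n : ℕ) (g : DomainSAW Ω δ a b → ℝ),
        (∀ γ γ' : DomainSAW Ω δ a b,
          (γ.walk.takeUntil (γ.walk.getVert n) (γ.walk.getVert_mem_support n)).support =
            (γ'.walk.takeUntil (γ'.walk.getVert n) (γ'.walk.getVert_mem_support n)).support →
          g γ = g γ') → Measurable[𝒢 n] g) ∧
      (∀ (μ : Measure (DomainSAW Ω δ a b)) [IsFiniteMeasure μ] (X : DomainSAW Ω δ a b → ℝ)
          (n : ℕ),
        μ[X | 𝒢 n] =ᵐ[μ] fun γ ↦
          (∫ x in {γ' : DomainSAW Ω δ a b | ∃ hw : γ.walk.getVert n ∈ γ'.walk.support,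
              γ'.walk.takeUntil (γ.walk.getVert n) hw =
                γ.walk.takeUntil (γ.walk.getVert n) (γ.walk.getVert_mem_support n)}, X x ∂μ) /
            (μ {γ' : DomainSAW Ω δ a b | ∃ hw : γ.walk.getVert n ∈ γ'.walk.support,
              γ'.walk.takeUntil (γ.walk.getVert n) hw =
                γ.walk.takeUntil (γ.walk.getVert n) (γ.walk.getVert_mem_support n)}).toReal) ∧
      (∀ g : DomainSAW Ω δ a b → ℝ,
        (∀ (k i : ℕ) (γ γ' : DomainSAW Ω δ a b), σ γ = k → i ≤ k → s ≤ f γ i →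
          (γ.walk.takeUntil (γ.walk.getVert i) (γ.walk.getVert_mem_support i)).support =
            (γ'.walk.takeUntil (γ'.walk.getVert i) (γ'.walk.getVert_mem_support i)).support →
          g γ = g γ') →
        Measurable[hσ.measurableSpace] g) ∧
      (∀ (γ : DomainSAW Ω δ a b) (T : ℝ), s + θ ≤ T → (∃ k, T < f γ k) →
        (∀ k, f γ k ≤ T → f γ (k + 1) - f γ k ≤ θ) →
        ∃ k : ℕ, σ γ = k ∧ s ≤ f γ k ∧ f γ k ≤ s + θ) ∧
      (∀ (γ : DomainSAW Ω δ a b) (T : ℝ), t + θ ≤ T → (∃ k, T < f γ k) →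
        (∀ k, f γ k ≤ T → f γ (k + 1) - f γ k ≤ θ) →
        ∃ k : ℕ, τ γ = k ∧ t ≤ f γ k ∧ f γ k ≤ t + θ) := by
  -- the past-support maps; pasts are nested
  set sig : ℕ → DomainSAW Ω δ a b → List (Site 2) := fun n γ ↦
    (γ.walk.takeUntil (γ.walk.getVert n) (γ.walk.getVert_mem_support n)).support with hsig
  have hnest : ∀ {i n : ℕ}, i ≤ n → ∀ {γ γ' : DomainSAW Ω δ a b}, sig n γ = sig n γ' →
      sig i γ = sig i γ' :=
    fun hin γ γ' h ↦ support_takeUntil_getVert_eq_of_le γ.isPath γ'.isPath hin h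
  -- the running-max clock is prefix-determined
  have hcdet : ∀ (γ γ' : DomainSAW Ω δ a b) (n : ℕ), sig n γ = sig n γ' →
      partialSups (f γ) n = partialSups (f γ') n := by
    intro γ γ' n h
    have key : ∀ i ≤ n, f γ i = f γ' i := fun i hi ↦ hf γ γ' i i (hnest hi h)
    refine le_antisymm (partialSups_le _ _ _ fun i hi ↦ ?_) (partialSups_le _ _ _ fun i hi ↦ ?_)
    · rw [key i hi]; exact le_partialSups_of_le _ hi
    · rw [← key i hi]; exact le_partialSups_of_le _ hi
  obtain ⟨𝒢, M, σ, τ, hσ, hτ, hστ, hτM, hMlen, h𝒢, hDoob, hσspec, hτspec, hσlt, -, hσmeas, hfull⟩ :=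
    exists_explorationFiltration (fun (γ : DomainSAW Ω δ a b) n ↦ partialSups (f γ) n) hcdet hst
  -- every value of the clock is below the terminal running max
  have hfM : ∀ (γ : DomainSAW Ω δ a b) (k : ℕ), f γ k ≤ partialSups (f γ) M := by
    intro γ k
    rcases le_total k M with hk | hk
    · exact le_partialSups_of_le (f γ) hk
    · have h1 : sig k γ = sig M γ := by
        simp only [hsig]
        rw [hfull γ k ((hMlen γ).trans hk), hfull γ M (hMlen γ)]
      rw [hf γ γ k M h1]
      exact le_partialSups (f γ) M
  -- first passages of the running max: the clock itself sits in `[L, L + θ]`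
  have hpass : ∀ (L : ℝ) (ϑ : DomainSAW Ω δ a b → WithTop ℕ) (γ : DomainSAW Ω δ a b), 0 ≤ L →
      (∃ k : ℕ, ϑ γ = k ∧ k ≤ M ∧ (L ≤ partialSups (f γ) M →
        L ≤ partialSups (f γ) k ∧ ∀ j < k, partialSups (f γ) j < L)) →
      ∀ T : ℝ, L + θ ≤ T → (∃ k, T < f γ k) → (∀ k, f γ k ≤ T → f γ (k + 1) - f γ k ≤ θ) →
      ∃ k : ℕ, ϑ γ = k ∧ L ≤ f γ k ∧ f γ k ≤ L + θ := by
    rintro L ϑ γ hL ⟨k, hϑk, -, hspec⟩ T hLT ⟨k₀, hk₀⟩ hincr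
    obtain ⟨hLk, hbefore⟩ := hspec (by linarith [hfM γ k₀])
    -- the running max at the first passage is realised by the last past
    obtain ⟨j, hjk, hcj⟩ := exists_partialSups_eq (f γ) k
    have hjk' : j = k := by
      by_contra hne
      have h1 := hbefore j (lt_of_le_of_ne hjk hne)
      have h2 : f γ j ≤ partialSups (f γ) j := le_partialSups (f γ) j
      linarith
    subst hjk'
    refine ⟨j, hϑk, hcj ▸ hLk, ?_⟩
    -- no overshoot: the previous past has clock `< L ≤ T`
    rcases j with _ | i
    · linarith [h0 γ]
    · have hi : f γ i < L :=
        (le_partialSups (f γ) i).trans_lt (hbefore i (Nat.lt_succ_self i))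
      have := hincr i (by linarith)
      linarith
  refine ⟨𝒢, M, σ, τ, hσ, hτ, hστ, hτM, h𝒢, hDoob, fun g hg ↦ hσmeas g fun k γ γ' hk hkM h ↦ ?_,
    fun γ T ↦ hpass s σ γ hs (hσspec γ) T, fun γ T ↦ hpass t τ γ (hs.trans hst) (hτspec γ) T⟩
  -- measurability for `𝒢_σ`: on `{σ = k < M}` some past `γ[0,i]`, `i ≤ k`, has clock `≥ s`
  obtain ⟨i, hik, hci⟩ := exists_partialSups_eq (f γ) k
  exact hg k i γ γ' hk hik (hci ▸ hσlt γ k hk hkM) (hnest hik h)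

end Literature.Probability.RandomPlanarGeometry.SAW

end
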